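import Mathlib
import Literature.Probability.Moments.AdaptedIndicatorChernoff
import HarnessLib

/-!
# Crux `NNLinearDegreeCofactorHard` (stmt-ValiantsHypothesis-23918), line `internal_cofactor`, stub S2b (ii):
# an Azuma–Hoeffding COUNT for adapted `±1` walks on the cube (the pricing tool for the μ* band and regularity)

Counting form of the exponential-moment bound for a walk on the uniform cube `Fin N → Bool` whose step at coordinate
`s` is `±1` according to the bit `y s` when an ADAPTED activity predicate `act s y` (a function of the bits `< s`)
holds, and `0` otherwise:

* `sum_exp_walk_div_eq` — the exact identity `∑_y exp(l·W_t(y)) · (cosh l)^{-(#active steps < t)} = 2^N`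
  (pair `y` with `y` flipped at coordinate `t`: the past is unchanged, the step changes sign);
* `sum_exp_walk_le` — if every `y` has at most `f` active steps, `∑_y exp(l·W_N(y)) ≤ (cosh l)^f · 2^N ≤ exp(l²f/2) · 2^N`;
* `card_filter_walk_ge_le`, `card_filter_walk_le_neg_le` — the tails `#{y : a ≤ ±W(y)} ≤ exp(−a²/(2f)) · 2^N`.

Used by `…ShedWordBand` with `act` = «position `s` is fair» (the S-content band of the design memo
`Lines/internal_cofactor-S2b-shed-design-p1.md`) and with `act` = «fair with fair-rank in a window» (regularity).
Elementary; nothing here bears on VP ≠ VNP (not proved). [folklore]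
-/

noncomputable section

-- Sub = Summit single-conjunct layout: the duplicated namespace component is mandated by the tree.
set_option linter.dupNamespace false

namespace Summit.ValiantsHypothesis.ValiantsHypothesis.Theorems.FifoMatching.NNLinearDegreeCofactorHard.AdaptedWalk

open Finset Real

variable {N : ℕ}

/-- The bit of `y` at a natural-number coordinate (`false` past the end). [folklore] -/
def cbit (y : Fin N → Bool) (s : ℕ) : Bool := if h : s < N then y ⟨s, h⟩ else false

/-- The step of the walk at coordinate `s`: `±1` by the bit when active, else `0`. [folklore] -/
def step (act : ℕ → (Fin N → Bool) → Bool) (s : ℕ) (y : Fin N → Bool) : ℝ :=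
  if act s y = true then (if cbit y s = true then 1 else -1) else 0

/-- The adapted walk up to time `t`. [folklore] -/
def walk (act : ℕ → (Fin N → Bool) → Bool) (t : ℕ) (y : Fin N → Bool) : ℝ :=
  ∑ s ∈ range t, step act s y

/-- The number of active steps before `t`. [folklore] -/
def nAct (act : ℕ → (Fin N → Bool) → Bool) (t : ℕ) (y : Fin N → Bool) : ℕ :=
  ((range t).filter fun s => act s y = true).card

/-- Flipping one coordinate. [folklore] -/
def flipAt (t : Fin N) (y : Fin N → Bool) : Fin N → Bool := Function.update y t (!y t)

/-- Flipping twice is the identity. [folklore] -/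
theorem flipAt_flipAt (t : Fin N) (y : Fin N → Bool) : flipAt t (flipAt t y) = y := by
  ext i
  unfold flipAt
  by_cases h : i = t
  · subst h; simp
  · simp [Function.update_of_ne h]

/-- Flipping coordinate `t` does not change earlier bits. [folklore] -/
theorem cbit_flipAt_of_lt (t : Fin N) (y : Fin N → Bool) {s : ℕ} (hs : s < t.val) : cbit (flipAt t y) s = cbit y s := by
  unfold cbit flipAt
  by_cases h : s < N
  · rw [dif_pos h, dif_pos h, Function.update_of_ne]
    exact fun he => by rw [Fin.ext_iff] at he; simp at he; omega
  · rw [dif_neg h, dif_neg h]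

/-- Flipping coordinate `t` negates bit `t`. [folklore] -/
theorem cbit_flipAt_self (t : Fin N) (y : Fin N → Bool) : cbit (flipAt t y) t = !cbit y t := by
  unfold cbit flipAt
  rw [dif_pos t.isLt, dif_pos t.isLt]
  simp

/-- An activity predicate is ADAPTED if `act s` is unchanged by flipping any coordinate `t ≥ s`. [folklore] -/
def Adapted (act : ℕ → (Fin N → Bool) → Bool) : Prop :=
  ∀ (s : ℕ) (t : Fin N) (y : Fin N → Bool), s ≤ t.val → act s (flipAt t y) = act s y

variable {act : ℕ → (Fin N → Bool) → Bool}

/-- Earlier steps are unchanged by a later flip. [folklore] -/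
theorem step_flipAt_of_lt (hact : Adapted act) (t : Fin N) (y : Fin N → Bool) {s : ℕ} (hs : s < t.val) :
    step act s (flipAt t y) = step act s y := by
  unfold step; rw [hact s t y (le_of_lt hs), cbit_flipAt_of_lt t y hs]

/-- The step at the flipped coordinate changes sign. [folklore] -/
theorem step_flipAt_self (hact : Adapted act) (t : Fin N) (y : Fin N → Bool) :
    step act t (flipAt t y) = -step act t y := by
  unfold step; rw [hact t t y le_rfl, cbit_flipAt_self]
  cases act t y <;> cases cbit y t <;> simp

/-- The walk up to `t` is unchanged by flipping coordinate `t`. [folklore] -/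
theorem walk_flipAt (hact : Adapted act) (t : Fin N) (y : Fin N → Bool) : walk act t (flipAt t y) = walk act t y :=
  sum_congr rfl fun _ hs => step_flipAt_of_lt hact t y (mem_range.1 hs)

/-- The active count up to `t` is unchanged by flipping coordinate `t`. [folklore] -/
theorem nAct_flipAt (hact : Adapted act) (t : Fin N) (y : Fin N → Bool) : nAct act t (flipAt t y) = nAct act t y := by
  unfold nAct
  congr 1
  exact filter_congr fun s hs => by rw [hact s t y (le_of_lt (mem_range.1 hs))]

/-- One step of the walk. [folklore] -/
theorem walk_succ (t : ℕ) (y : Fin N → Bool) : walk act (t + 1) y = walk act t y + step act t y := by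
  unfold walk; rw [sum_range_succ]

/-- One step of the active count. [folklore] -/
theorem nAct_succ (t : ℕ) (y : Fin N → Bool) :
    nAct act (t + 1) y = nAct act t y + (if act t y = true then 1 else 0) := by
  unfold nAct
  rw [range_add_one, filter_insert]
  by_cases h : act t y = true
  · rw [if_pos h, if_pos h, card_insert_of_notMem (by simp)]
  · rw [if_neg h, if_neg h, add_zero]

/-- **The exponential identity.**  For an adapted activity and `t ≤ N`:
`∑_y exp(l · W_t(y)) · (cosh l)⁻¹ ^ (#active steps < t) = 2^N`. [folklore] -/
theorem sum_exp_walk_div_eq (hact : Adapted act) (l : ℝ) {t : ℕ} (ht : t ≤ N) :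
    ∑ y : Fin N → Bool, Real.exp (l * walk act t y) * (Real.cosh l)⁻¹ ^ nAct act t y = 2 ^ N := by
  induction t with
  | zero =>
    simp [walk, nAct, Fintype.card_bool, Fintype.card_fin]
  | succ t ih =>
    have ih := ih (Nat.le_of_succ_le ht)
    have htN : t < N := ht
    set tt : Fin N := ⟨t, htN⟩
    have hc : (0 : ℝ) < Real.cosh l := Real.cosh_pos l
    -- the summand at time `t + 1` and its flip partner average to the summand at time `t`
    set F : (Fin N → Bool) → ℝ := fun y =>
      Real.exp (l * walk act (t + 1) y) * (Real.cosh l)⁻¹ ^ nAct act (t + 1) y with hF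
    set G : (Fin N → Bool) → ℝ := fun y =>
      Real.exp (l * walk act t y) * (Real.cosh l)⁻¹ ^ nAct act t y with hG
    have hpair : ∀ y, F y + F (flipAt tt y) = 2 * G y := by
      intro y
      have hw : walk act t (flipAt tt y) = walk act t y := walk_flipAt hact tt y
      have hn : nAct act t (flipAt tt y) = nAct act t y := nAct_flipAt hact tt y
      have hs : step act t (flipAt tt y) = -step act t y := step_flipAt_self hact tt y
      have ha' : act t (flipAt tt y) = act t y := hact t tt y le_rfl
      simp only [hF, hG, walk_succ, nAct_succ, hw, hn, hs, ha']
      by_cases ha : act t y = true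
      · rw [if_pos ha]
        have hstep : step act t y = 1 ∨ step act t y = -1 := by
          unfold step; rw [if_pos ha]; cases cbit y t <;> simp
        have hcosh : Real.exp (l * step act t y) + Real.exp (l * -step act t y) = 2 * Real.cosh l := by
          rw [Real.cosh_eq]
          rcases hstep with h | h <;> rw [h] <;> ring_nf
        rw [pow_succ, mul_add, mul_add, Real.exp_add, Real.exp_add]
        calc Real.exp (l * walk act t y) * Real.exp (l * step act t y) * ((Real.cosh l)⁻¹ ^ nAct act t y * (Real.cosh l)⁻¹) +
              Real.exp (l * walk act t y) * Real.exp (l * -step act t y) * ((Real.cosh l)⁻¹ ^ nAct act t y * (Real.cosh l)⁻¹)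
            = Real.exp (l * walk act t y) * (Real.cosh l)⁻¹ ^ nAct act t y *
                ((Real.exp (l * step act t y) + Real.exp (l * -step act t y)) * (Real.cosh l)⁻¹) := by ring
          _ = 2 * (Real.exp (l * walk act t y) * (Real.cosh l)⁻¹ ^ nAct act t y) := by
                rw [hcosh]; field_simp
      · rw [if_neg ha, add_zero]
        have hstep : step act t y = 0 := by unfold step; rw [if_neg ha]
        rw [hstep, neg_zero, add_zero]
        ring
    -- sum over the involution `flipAt tt`
    have hsum : ∑ y, F y = ∑ y, F (flipAt tt y) :=
      (Fintype.sum_bijective (flipAt tt) (Function.Involutive.bijective (flipAt_flipAt tt)) _ _ fun _ => rfl).symm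
    have h2 : 2 * ∑ y, F y = 2 * ∑ y, G y := by
      calc 2 * ∑ y, F y = ∑ y, F y + ∑ y, F (flipAt tt y) := by rw [← hsum]; ring
        _ = ∑ y, (F y + F (flipAt tt y)) := (sum_add_distrib).symm
        _ = ∑ y, 2 * G y := sum_congr rfl fun y _ => hpair y
        _ = 2 * ∑ y, G y := (mul_sum _ _ _).symm
    have : ∑ y, F y = ∑ y, G y := by linarith
    rw [this]
    exact ih

/-- **Exponential moment bound**: at most `f` active steps ⟹ `∑_y exp(l·W_N(y)) ≤ (cosh l)^f · 2^N`. [folklore] -/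
theorem sum_exp_walk_le (hact : Adapted act) (l : ℝ) {t : ℕ} (ht : t ≤ N) {f : ℕ} (hf : ∀ y, nAct act t y ≤ f) :
    ∑ y : Fin N → Bool, Real.exp (l * walk act t y) ≤ (Real.cosh l) ^ f * 2 ^ N := by
  have hc : (0 : ℝ) < Real.cosh l := Real.cosh_pos l
  have h1 : (1 : ℝ) ≤ Real.cosh l := Real.one_le_cosh l
  rw [← sum_exp_walk_div_eq hact l ht, mul_sum]
  refine sum_le_sum fun y _ => ?_
  have hn := hf y
  calc Real.exp (l * walk act t y)
      = Real.cosh l ^ nAct act t y * (Real.exp (l * walk act t y) * (Real.cosh l)⁻¹ ^ nAct act t y) := by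
          rw [inv_pow]; field_simp
    _ ≤ Real.cosh l ^ f * (Real.exp (l * walk act t y) * (Real.cosh l)⁻¹ ^ nAct act t y) := by
          apply mul_le_mul_of_nonneg_right (pow_le_pow_right₀ h1 hn)
          positivity

/-- **Upper tail**: `#{y : a ≤ W_t(y)} ≤ exp(−a²/(2f)) · 2^N` (`0 ≤ a`, `0 < f`, at most `f` active steps). [folklore] -/
theorem card_filter_walk_ge_le (hact : Adapted act) {t : ℕ} (ht : t ≤ N) {f : ℕ} (hf0 : 0 < f)
    (hf : ∀ y, nAct act t y ≤ f) {a : ℝ} (ha : 0 ≤ a) :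
    (((univ : Finset (Fin N → Bool)).filter fun y => a ≤ walk act t y).card : ℝ) ≤
      Real.exp (-(a ^ 2 / (2 * f))) * 2 ^ N := by
  set l : ℝ := a / f with hl
  have hfpos : (0 : ℝ) < f := by exact_mod_cast hf0
  have hmarkov := Literature.Probability.Moments.card_filter_mul_exp_le_sum_exp (univ : Finset (Fin N → Bool))
    (walk act t) (fun y => a ≤ walk act t y) a l
    (fun y _ hy => mul_le_mul_of_nonneg_left hy (div_nonneg ha hfpos.le))
  have hmom := sum_exp_walk_le hact l ht hf
  have hcosh : Real.cosh l ^ f ≤ Real.exp (l ^ 2 / 2 * f) := by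
    calc Real.cosh l ^ f ≤ (Real.exp (l ^ 2 / 2)) ^ f :=
          pow_le_pow_left₀ (Real.cosh_pos l).le (Real.cosh_le_exp_half_sq l) f
      _ = Real.exp (l ^ 2 / 2 * f) := by rw [← Real.exp_nat_mul]; ring_nf
  have hexp : (0 : ℝ) < Real.exp (l * a) := Real.exp_pos _
  have hkey : (((univ : Finset (Fin N → Bool)).filter fun y => a ≤ walk act t y).card : ℝ) ≤
      Real.exp (l ^ 2 / 2 * f) * 2 ^ N / Real.exp (l * a) := by
    rw [le_div_iff₀ hexp]
    exact hmarkov.trans (hmom.trans (mul_le_mul_of_nonneg_right hcosh (by positivity)))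
  have heq : Real.exp (l ^ 2 / 2 * f) * 2 ^ N / Real.exp (l * a) = Real.exp (-(a ^ 2 / (2 * f))) * 2 ^ N := by
    rw [mul_div_right_comm, ← Real.exp_sub]
    congr 2
    rw [hl]; field_simp; ring
  rw [heq] at hkey
  exact hkey

/-- **Lower tail**: `#{y : W_t(y) ≤ −a} ≤ exp(−a²/(2f)) · 2^N`. [folklore] -/
theorem card_filter_walk_le_neg_le (hact : Adapted act) {t : ℕ} (ht : t ≤ N) {f : ℕ} (hf0 : 0 < f)
    (hf : ∀ y, nAct act t y ≤ f) {a : ℝ} (ha : 0 ≤ a) :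
    (((univ : Finset (Fin N → Bool)).filter fun y => walk act t y ≤ -a).card : ℝ) ≤
      Real.exp (-(a ^ 2 / (2 * f))) * 2 ^ N := by
  set l : ℝ := -(a / f) with hl
  have hfpos : (0 : ℝ) < f := by exact_mod_cast hf0
  have hmarkov := Literature.Probability.Moments.card_filter_mul_exp_le_sum_exp (univ : Finset (Fin N → Bool))
    (walk act t) (fun y => walk act t y ≤ -a) (-a) l
    (fun y _ hy => by
      rw [hl, neg_mul, neg_mul, neg_le_neg_iff]
      exact mul_le_mul_of_nonneg_left hy (div_nonneg ha hfpos.le))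
  have hmom := sum_exp_walk_le hact l ht hf
  have hcosh : Real.cosh l ^ f ≤ Real.exp (l ^ 2 / 2 * f) := by
    calc Real.cosh l ^ f ≤ (Real.exp (l ^ 2 / 2)) ^ f :=
          pow_le_pow_left₀ (Real.cosh_pos l).le (Real.cosh_le_exp_half_sq l) f
      _ = Real.exp (l ^ 2 / 2 * f) := by rw [← Real.exp_nat_mul]; ring_nf
  have hexp : (0 : ℝ) < Real.exp (l * -a) := Real.exp_pos _
  have hkey : (((univ : Finset (Fin N → Bool)).filter fun y => walk act t y ≤ -a).card : ℝ) ≤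
      Real.exp (l ^ 2 / 2 * f) * 2 ^ N / Real.exp (l * -a) := by
    rw [le_div_iff₀ hexp]
    exact hmarkov.trans (hmom.trans (mul_le_mul_of_nonneg_right hcosh (by positivity)))
  have heq : Real.exp (l ^ 2 / 2 * f) * 2 ^ N / Real.exp (l * -a) = Real.exp (-(a ^ 2 / (2 * f))) * 2 ^ N := by
    rw [mul_div_right_comm, ← Real.exp_sub]
    congr 2
    rw [hl]; field_simp; ring
  rw [heq] at hkey
  exact hkey

end Summit.ValiantsHypothesis.ValiantsHypothesis.Theorems.FifoMatching.NNLinearDegreeCofactorHard.AdaptedWalk
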